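import Literature.NumberTheory.LFunctions.SelbergMollifierLemma1012
import HarnessLib

/-!
# Titchmarsh's Lemmas 10.13–10.14: the quadratic form `S(θ) = O(X^{2θ}/log X)`

Third support file for the proof of A. Selberg's positive-proportion theorem in the arrangement
of E. C. Titchmarsh, *The Theory of the Riemann Zeta-Function*, 2nd ed. (1986), §10.9–§10.22.
Everything here is PROVED; no named facts.

With `β_ν = α_ν(1 - log ν/log X)` (`selbergBeta X`), `1 ≤ κ, λ, μ, ν < X` (`mollRange X`) and
`q = (κν, λμ)`, Titchmarsh's quadratic form (§10.11) is
`S(θ) = ∑_{κλμν} (q/κμ)^{1-θ} β_κβ_λβ_μβ_ν/(λν)` (`Squad X θ`). **Lemma 10.14**: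
`S(θ) = O(X^{2θ}/log X)` uniformly in `0 ≤ θ ≤ ½` (`Squad_le`; we allow `0 ≤ θ ≤ 1`).

## The argument (Titchmarsh §10.11–10.14)

* §1–§2: the `ρ`-part `rhoPart ρ n = ∏_{p∣ρ} p^{v_p(n)}` of an integer and the unique
  factorisation `n = d κ'` with `d` `ρ`-smooth and `(κ', ρ) = 1`; the resulting reindexing of sums
  over `1 ≤ κ < X` (`sum_mollRange_eq_sum_rhoPart`).
* §3: `φ_s = N^s ∗ μ` (`phiPow`), `q^s = ∑_{ρ∣q} φ_s(ρ)`, `0 ≤ φ_s(ρ) ≤ ρ^s` (`s ≥ 0`); hence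
  (§10.11) `S(θ) = ∑_ρ φ_{1-θ}(ρ) y_ρ(θ)²` with `y_ρ(θ) = ∑_{ρ∣κν} β_κβ_ν κ^{θ-1}/ν`
  (`Squad_eq_sum_phiPow_mul_sq`).
* §4 (§10.11, p. 260): `y_ρ(θ) = (log X)^{-2} ∑_{d,d₁ ρ-smooth, ρ∣dd₁} α_dα_{d₁} d^{θ-1}d₁^{-1} L_θ(X/d) L_0(X/d₁)`
  with `L_θ(Y) = mollLog θ Y ρ` (`yrho_eq`), using `β_{dκ'} = α_dα_κ' log(X/dκ')/log X`.
* §5 (Lemma 10.13, with `|α|∗|α| ≤ 1` for Titchmarsh's `α'`):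
  `∑_{ρ∣dd₁} |α_dα_{d₁}|/(dd₁) ≤ ρ⁻¹ ∏_{p∣ρ}(1-1/p)⁻¹ ≤ 2ρ⁻¹∏_{p∣ρ}(1+1/p)`.
* §6: `∑_{ρ≤N} ∏_{p∣ρ}(1+1/p)⁴/ρ = O(log N)` (Titchmarsh p. 262: `∏(1+1/p)⁴ = O(∑_{n∣ρ} n^{-1/2})`).
* §7: Lemma 10.12 (`abs_mollLog_le`) twice, §5, §6 ⇒ `|y_ρ(θ)| ≪ X^θ ∏(1+1/p)²/(ρ log X)` and
  `S(θ) ≤ ∑_ρ ρ^{1-θ} y_ρ² ≪ X^{2θ}/log X` (Lemma 10.14).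

## References

* [Titchmarsh1986] E. C. Titchmarsh, *The Theory of the Riemann Zeta-Function*, 2nd ed. revised by
  D. R. Heath-Brown, Oxford 1986, §10.11, Lemma 10.12, Lemma 10.13, Lemma 10.14.
-/

noncomputable section

open Complex Real Finset ArithmeticFunction
open scoped ArithmeticFunction.Moebius ArithmeticFunction.zeta

namespace Literature.NumberTheory.LFunctions.SelbergMollifier

/-! ## §1 The `ρ`-part of an integer -/

/-- The **`ρ`-part** of `n`: `rhoPart ρ n = ∏_{p ∣ n, p ∣ ρ} p^{v_p(n)}` (Titchmarsh's `d` in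
`κ = dκ'`, §10.11). [cite: Titchmarsh1986, §10.11] -/
def rhoPart (ρ n : ℕ) : ℕ :=
  ∏ p ∈ n.primeFactors.filter (fun p : ℕ ↦ p ∣ ρ), p ^ n.factorization p

/-- `rhoPart ρ n ≠ 0`. [folklore] -/
theorem rhoPart_ne_zero (ρ n : ℕ) : rhoPart ρ n ≠ 0 :=
  Finset.prod_ne_zero_iff.mpr fun _ hp ↦
    pow_ne_zero _ (Nat.prime_of_mem_primeFactors (Finset.mem_filter.mp hp).1).ne_zero

/-- `v_p(rhoPart ρ n) = v_p(n)` if `p ∣ ρ`, and `0` otherwise. [folklore] -/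
theorem factorization_rhoPart (ρ n p : ℕ) :
    (rhoPart ρ n).factorization p = if p ∣ ρ then n.factorization p else 0 := by
  rw [rhoPart, Nat.factorization_prod fun q hq ↦
    pow_ne_zero _ (Nat.prime_of_mem_primeFactors (Finset.mem_filter.mp hq).1).ne_zero]
  rw [Finsupp.finsetSum_apply]
  have h : ∀ q ∈ n.primeFactors.filter (fun q : ℕ ↦ q ∣ ρ),
      (q ^ n.factorization q).factorization p = if q = p then n.factorization p else 0 := by
    intro q hq
    have hqp : q.Prime := Nat.prime_of_mem_primeFactors (Finset.mem_filter.mp hq).1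
    rw [hqp.factorization_pow, Finsupp.single_apply]
    split_ifs with h1
    · subst h1; rfl
    · rfl
  rw [Finset.sum_congr rfl h, Finset.sum_ite_eq']
  by_cases hpB : p ∣ ρ
  · rw [if_pos hpB]
    split_ifs with hmem
    · rfl
    · symm
      rw [Finset.mem_filter, not_and_or] at hmem
      rcases hmem with h1 | h1
      · exact Finsupp.notMem_support_iff.mp (by rwa [Nat.support_factorization])
      · exact absurd hpB h1
  · rw [if_neg hpB, if_neg]
    exact fun hmem ↦ hpB (Finset.mem_filter.mp hmem).2

/-- `rhoPart ρ n ∣ n` for `n ≠ 0`. [folklore] -/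
theorem rhoPart_dvd {n : ℕ} (hn : n ≠ 0) (ρ : ℕ) : rhoPart ρ n ∣ n := by
  rw [← Nat.factorization_le_iff_dvd (rhoPart_ne_zero ρ n) hn]
  intro p
  rw [factorization_rhoPart]
  split_ifs
  · exact le_rfl
  · exact Nat.zero_le _

/-- Every prime factor of `rhoPart ρ n` divides `ρ`. [folklore] -/
theorem dvd_of_prime_dvd_rhoPart {ρ n p : ℕ} (hp : p.Prime) (hpd : p ∣ rhoPart ρ n) : p ∣ ρ := by
  by_contra hpB
  have h1 : 1 ≤ (rhoPart ρ n).factorization p := hp.factorization_pos_of_dvd (rhoPart_ne_zero ρ n) hpd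
  rw [factorization_rhoPart, if_neg hpB] at h1
  exact Nat.not_succ_le_zero 0 h1

/-- The prime factors of `rhoPart ρ n` are prime factors of `ρ` (`ρ ≠ 0`). [folklore] -/
theorem primeFactors_rhoPart_subset {ρ : ℕ} (hρ : ρ ≠ 0) (n : ℕ) :
    (rhoPart ρ n).primeFactors ⊆ ρ.primeFactors := by
  intro p hp
  have hp' := Nat.prime_of_mem_primeFactors hp
  exact Nat.mem_primeFactors.mpr ⟨hp', dvd_of_prime_dvd_rhoPart hp' (Nat.dvd_of_mem_primeFactors hp), hρ⟩

/-- No prime factor of `ρ` divides the cofactor `n / rhoPart ρ n` (`n ≠ 0`). [folklore] -/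
theorem not_dvd_div_rhoPart {p ρ n : ℕ} (hp : p.Prime) (hpB : p ∣ ρ) (hn : n ≠ 0) :
    ¬ p ∣ n / rhoPart ρ n := by
  rw [hp.dvd_iff_one_le_factorization (Nat.div_ne_zero_iff_of_dvd (rhoPart_dvd hn ρ)
    |>.mpr ⟨hn, rhoPart_ne_zero ρ n⟩), Nat.factorization_div (rhoPart_dvd hn ρ),
    Finsupp.tsub_apply, factorization_rhoPart, if_pos hpB, Nat.sub_self]
  exact Nat.not_succ_le_zero 0

/-- The cofactor `n / rhoPart ρ n` is coprime to `ρ` (`n ≠ 0`). [folklore] -/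
theorem coprime_div_rhoPart {ρ n : ℕ} (hn : n ≠ 0) : (n / rhoPart ρ n).Coprime ρ :=
  Nat.coprime_of_dvd fun _ hp hpc hpρ ↦ not_dvd_div_rhoPart hp hpρ hn hpc

/-- `rhoPart ρ n * (n / rhoPart ρ n) = n` (`n ≠ 0`). [folklore] -/
theorem rhoPart_mul_div {n : ℕ} (hn : n ≠ 0) (ρ : ℕ) : rhoPart ρ n * (n / rhoPart ρ n) = n :=
  Nat.mul_div_cancel' (rhoPart_dvd hn ρ)

/-- **Uniqueness of the decomposition**: if every prime factor of `q ≠ 0` divides `ρ` and `r ≠ 0`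
is coprime to `ρ`, then `rhoPart ρ (q r) = q`. [folklore] -/
theorem rhoPart_mul_eq {ρ q r : ℕ} (hq : q ≠ 0) (hqρ : ∀ p : ℕ, p.Prime → p ∣ q → p ∣ ρ) (hr : r ≠ 0)
    (hrρ : r.Coprime ρ) : rhoPart ρ (q * r) = q := by
  refine Nat.eq_of_factorization_eq (rhoPart_ne_zero ρ _) hq fun p ↦ ?_
  rw [factorization_rhoPart, Nat.factorization_mul hq hr, Finsupp.add_apply]
  by_cases hp : p.Prime
  · split_ifs with hpB
    · have : ¬ p ∣ r := fun hpr ↦ by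
        have := Nat.Coprime.coprime_dvd_left hpr hrρ
        exact (Nat.Prime.coprime_iff_not_dvd hp).mp this hpB
      rw [Nat.factorization_eq_zero_of_not_dvd this, add_zero]
    · symm
      exact Nat.factorization_eq_zero_of_not_dvd fun hpq ↦ hpB (hqρ p hp hpq)
  · simp [Nat.factorization_eq_zero_of_not_prime _ hp]

/-! ## §2 Reindexing sums over `1 ≤ κ < X` by `κ = d κ'` -/

/-- The `ρ`-smooth elements of `mollRange X` (those all of whose prime factors divide `ρ`).
[folklore] -/
def smoothRange (ρ : ℕ) (X : ℝ) : Finset ℕ :=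
  (mollRange X).filter fun d ↦ ∀ p ∈ d.primeFactors, p ∣ ρ

/-- The elements of `mollRange Y` coprime to `ρ`. [folklore] -/
def copRange (ρ : ℕ) (Y : ℝ) : Finset ℕ := (mollRange Y).filter fun k ↦ k.Coprime ρ

/-- Membership in `smoothRange`. [folklore] -/
theorem mem_smoothRange {ρ : ℕ} {X : ℝ} {d : ℕ} :
    d ∈ smoothRange ρ X ↔ (1 ≤ d ∧ (d : ℝ) < X) ∧ ∀ p : ℕ, p.Prime → p ∣ d → p ∣ ρ := by
  rw [smoothRange, Finset.mem_filter, mem_mollRange]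
  constructor
  · rintro ⟨h1, h2⟩
    refine ⟨h1, fun p hp hpd ↦ h2 p (Nat.mem_primeFactors.mpr ⟨hp, hpd, by omega⟩)⟩
  · rintro ⟨h1, h2⟩
    exact ⟨h1, fun p hp ↦ h2 p (Nat.prime_of_mem_primeFactors hp) (Nat.dvd_of_mem_primeFactors hp)⟩

/-- Membership in `copRange`. [folklore] -/
theorem mem_copRange {ρ : ℕ} {Y : ℝ} {k : ℕ} :
    k ∈ copRange ρ Y ↔ (1 ≤ k ∧ (k : ℝ) < Y) ∧ k.Coprime ρ := by
  rw [copRange, Finset.mem_filter, mem_mollRange]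

/-- **Reindexing by the decomposition `κ = d κ'`** (`d` `ρ`-smooth, `(κ', ρ) = 1`):
`∑_{1≤κ<X} F(κ) = ∑_{d} ∑_{κ'<X/d,(κ',ρ)=1} F(dκ')`. [cite: Titchmarsh1986, §10.11] -/
theorem sum_mollRange_eq_sum_rhoPart (ρ : ℕ) (X : ℝ) (F : ℕ → ℝ) :
    ∑ κ ∈ mollRange X, F κ = ∑ d ∈ smoothRange ρ X, ∑ k ∈ copRange ρ (X / d), F (d * k) := by
  rw [Finset.sum_sigma']
  refine Finset.sum_bij' (fun κ _ ↦ ⟨rhoPart ρ κ, κ / rhoPart ρ κ⟩) (fun x _ ↦ x.1 * x.2) ?_ ?_ ?_ ?_ ?_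
  · intro κ hκ
    obtain ⟨h1, hX⟩ := mem_mollRange.mp hκ
    have hκ0 : κ ≠ 0 := by omega
    have hd := rhoPart_ne_zero ρ κ
    have hdle : rhoPart ρ κ ≤ κ := Nat.le_of_dvd (by omega) (rhoPart_dvd hκ0 ρ)
    have hdpos : (0 : ℝ) < rhoPart ρ κ := by exact_mod_cast Nat.pos_of_ne_zero hd
    rw [Finset.mem_sigma, mem_smoothRange, mem_copRange]
    refine ⟨⟨⟨Nat.one_le_iff_ne_zero.mpr hd, lt_of_le_of_lt (by exact_mod_cast hdle) hX⟩,
      fun p hp hpd ↦ dvd_of_prime_dvd_rhoPart hp hpd⟩, ⟨?_, ?_⟩, coprime_div_rhoPart hκ0⟩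
    · exact Nat.div_pos hdle (Nat.pos_of_ne_zero hd)
    · rw [lt_div_iff₀ hdpos]
      calc ((κ / rhoPart ρ κ : ℕ) : ℝ) * rhoPart ρ κ = κ := by
            rw [mul_comm]; exact_mod_cast rhoPart_mul_div hκ0 ρ
        _ < X := hX
  · intro x hx
    rw [Finset.mem_sigma, mem_smoothRange, mem_copRange] at hx
    obtain ⟨⟨⟨hd1, hdX⟩, _⟩, ⟨hk1, hkX⟩, _⟩ := hx
    have hdpos : (0 : ℝ) < x.1 := by exact_mod_cast hd1
    rw [mem_mollRange]
    refine ⟨Nat.one_le_iff_ne_zero.mpr (mul_ne_zero (by omega) (by omega)), ?_⟩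
    rw [lt_div_iff₀ hdpos] at hkX
    push_cast
    linarith [mul_comm (x.1 : ℝ) x.2]
  · intro κ hκ
    have hκ0 : κ ≠ 0 := by have := (mem_mollRange.mp hκ).1; omega
    exact rhoPart_mul_div hκ0 ρ
  · intro x hx
    rw [Finset.mem_sigma, mem_smoothRange, mem_copRange] at hx
    obtain ⟨⟨⟨hd1, _⟩, hdρ⟩, ⟨hk1, _⟩, hkρ⟩ := hx
    have hq : x.1 ≠ 0 := by omega
    have hr : x.2 ≠ 0 := by omega
    have h1 : rhoPart ρ (x.1 * x.2) = x.1 := rhoPart_mul_eq hq hdρ hr hkρ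
    have h2 : x.1 * x.2 / rhoPart ρ (x.1 * x.2) = x.2 := by
      rw [h1, Nat.mul_div_cancel_left _ (Nat.pos_of_ne_zero hq)]
    exact Sigma.ext h1 (heq_of_eq h2)
  · intro κ hκ
    have hκ0 : κ ≠ 0 := by have := (mem_mollRange.mp hκ).1; omega
    simp only
    rw [rhoPart_mul_div hκ0 ρ]

/-! ## §3 The functions `φ_s = N^s ∗ μ` and the expansion of `gcd^s` -/

/-- `n ↦ n^s` (real `s`) as an arithmetic function. [folklore] -/
def powArith (s : ℝ) : ArithmeticFunction ℝ := ⟨fun n ↦ if n = 0 then 0 else (n : ℝ) ^ s, if_pos rfl⟩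

/-- `powArith s n = n^s` for `n ≠ 0`. [folklore] -/
theorem powArith_apply {s : ℝ} {n : ℕ} (hn : n ≠ 0) : powArith s n = (n : ℝ) ^ s := if_neg hn

/-- `powArith s` is multiplicative. [folklore] -/
theorem isMultiplicative_powArith (s : ℝ) : (powArith s).IsMultiplicative := by
  refine ⟨by simp [powArith], fun {m n} _ ↦ ?_⟩
  rcases eq_or_ne m 0 with rfl | hm
  · simp [powArith]
  rcases eq_or_ne n 0 with rfl | hn
  · simp [powArith]
  rw [powArith_apply (mul_ne_zero hm hn), powArith_apply hm, powArith_apply hn, Nat.cast_mul,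
    Real.mul_rpow (by positivity) (by positivity)]

/-- **Titchmarsh's `φ_{-θ}` (§9.24, §10.11)**: `phiPow s = N^s ∗ μ`, i.e.
`φ_s(ρ) = ∑_{d∣ρ} μ(ρ/d) d^s = ρ^s ∏_{p∣ρ}(1 - p^{-s})`. [cite: Titchmarsh1986, §10.11] -/
def phiPow (s : ℝ) : ArithmeticFunction ℝ := powArith s * (μ : ArithmeticFunction ℝ)

/-- **`q^s = ∑_{ρ∣q} φ_s(ρ)`** (`q ≥ 1`). [cite: Titchmarsh1986, §10.11] -/
theorem sum_divisors_phiPow {s : ℝ} {n : ℕ} (hn : n ≠ 0) :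
    ∑ d ∈ n.divisors, phiPow s d = (n : ℝ) ^ s := by
  have h : phiPow s * (ζ : ArithmeticFunction ℝ) = powArith s := by
    rw [phiPow, mul_assoc, coe_moebius_mul_coe_zeta, mul_one]
  rw [← coe_mul_zeta_apply, h, powArith_apply hn]

/-- `phiPow s` is multiplicative. [folklore] -/
theorem isMultiplicative_phiPow (s : ℝ) : (phiPow s).IsMultiplicative :=
  (isMultiplicative_powArith s).mul isMultiplicative_moebius.intCast

/-- `φ_s(p^k) ≥ 0` for `s ≥ 0` (it is `1` for `k = 0` and `p^{ks} - p^{(k-1)s}` for `k ≥ 1`).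
[folklore] -/
theorem phiPow_prime_pow_nonneg {s : ℝ} (hs : 0 ≤ s) {p : ℕ} (hp : p.Prime) (k : ℕ) :
    0 ≤ phiPow s (p ^ k) := by
  rw [phiPow, mul_apply_prime_pow hp]
  rcases Nat.eq_zero_or_pos k with rfl | hk
  · simp [powArith]
  obtain ⟨m, rfl⟩ : ∃ m, k = m + 1 := ⟨k - 1, by omega⟩
  rw [Finset.sum_range_succ, Finset.sum_range_succ]
  have hrest : ∑ e ∈ Finset.range m, powArith s (p ^ e) * (μ : ArithmeticFunction ℝ) (p ^ (m + 1 - e)) = 0 := by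
    refine Finset.sum_eq_zero fun e he ↦ ?_
    rw [Finset.mem_range] at he
    rw [ArithmeticFunction.intCoe_apply, ArithmeticFunction.moebius_apply_prime_pow hp (by omega),
      if_neg (by omega)]
    simp
  rw [hrest, zero_add, show m + 1 - m = 1 by omega, Nat.sub_self, pow_zero, pow_one,
    ArithmeticFunction.intCoe_apply, ArithmeticFunction.intCoe_apply, ArithmeticFunction.moebius_apply_prime hp,
    ArithmeticFunction.moebius_apply_one, powArith_apply (pow_ne_zero _ hp.ne_zero),
    powArith_apply (pow_ne_zero _ hp.ne_zero)]
  push_cast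
  have hp1 : (1 : ℝ) ≤ p := by exact_mod_cast hp.one_lt.le
  have : ((p : ℝ) ^ m) ^ s ≤ ((p : ℝ) ^ (m + 1)) ^ s :=
    Real.rpow_le_rpow (by positivity) (pow_le_pow_right₀ hp1 (by omega)) hs
  linarith

/-- **`φ_s ≥ 0`** for `s ≥ 0`. [folklore] -/
theorem phiPow_nonneg {s : ℝ} (hs : 0 ≤ s) (n : ℕ) : 0 ≤ phiPow s n := by
  rcases eq_or_ne n 0 with rfl | hn
  · simp
  rw [(isMultiplicative_phiPow s).multiplicative_factorization _ hn]
  exact Finset.prod_nonneg fun p hp ↦ phiPow_prime_pow_nonneg hs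
    (Nat.prime_of_mem_primeFactors (by rwa [Nat.support_factorization] at hp)) _

/-- **`φ_s(ρ) ≤ ρ^s`** for `s ≥ 0`, `ρ ≥ 1`. [folklore] -/
theorem phiPow_le_rpow {s : ℝ} (hs : 0 ≤ s) {n : ℕ} (hn : n ≠ 0) : phiPow s n ≤ (n : ℝ) ^ s := by
  rw [← sum_divisors_phiPow hn]
  exact Finset.single_le_sum (fun d _ ↦ phiPow_nonneg hs d) (Nat.mem_divisors_self n hn)

/-! ## §4 The average bound `∑_{ρ≤N} ∏_{p∣ρ}(1+1/p)⁴/ρ = O(log N)` -/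

/-- `P_ρ = ∏_{p∣ρ}(1 + 1/p)`. [cite: Titchmarsh1986, Lemma 10.12] -/
def primeProd (ρ : ℕ) : ℝ := ∏ p ∈ ρ.primeFactors, (1 + (p : ℝ)⁻¹)

/-- `1 ≤ P_ρ`. [folklore] -/
theorem one_le_primeProd (ρ : ℕ) : 1 ≤ primeProd ρ := one_le_prod_one_add_inv ρ

/-- `0 < P_ρ`. [folklore] -/
theorem primeProd_pos (ρ : ℕ) : 0 < primeProd ρ := lt_of_lt_of_le one_pos (one_le_primeProd ρ)

/-- `(1+x)⁴ ≤ 1 + 15x` for `0 ≤ x ≤ ½`. [folklore] -/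
theorem one_add_pow_four_le {x : ℝ} (h0 : 0 ≤ x) (h1 : x ≤ 1 / 2) : (1 + x) ^ 4 ≤ 1 + 15 * x := by
  nlinarith [mul_nonneg h0 h0, mul_nonneg (mul_nonneg h0 h0) h0, mul_nonneg (mul_nonneg h0 h0) (mul_nonneg h0 h0)]

/-- `P_ρ⁴ ≤ ∏_{p∣ρ}(1 + 15/p)`. [cite: Titchmarsh1986, §10.14] -/
theorem primeProd_pow_four_le (ρ : ℕ) :
    primeProd ρ ^ 4 ≤ ∏ p ∈ ρ.primeFactors, (1 + 15 * (p : ℝ)⁻¹) := by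
  rw [primeProd, ← Finset.prod_pow]
  refine Finset.prod_le_prod (fun p _ ↦ by positivity) fun p hp ↦ ?_
  have hp2 : (2 : ℝ) ≤ p := by exact_mod_cast (Nat.prime_of_mem_primeFactors hp).two_le
  exact one_add_pow_four_le (by positivity) (by rw [inv_le_comm₀ (by linarith) (by norm_num)]; linarith)

/-- For a finite set `t` of primes: `∏_{p∈t} 15/p ≤ 15^{256} (∏_{p∈t} p)^{-1/2}`. [folklore] -/
theorem prod_fifteen_div_le {t : Finset ℕ} (ht : ∀ p ∈ t, p.Prime) :
    ∏ p ∈ t, (15 * (p : ℝ)⁻¹) ≤ (15 : ℝ) ^ 256 * ((∏ p ∈ t, p : ℕ) : ℝ) ^ (-(1 / 2 : ℝ)) := by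
  -- `15/p = (15 p^{-1/2}) · p^{-1/2}`
  have hsplit : ∀ p ∈ t, 15 * (p : ℝ)⁻¹ = (15 * (p : ℝ) ^ (-(1 / 2 : ℝ))) * (p : ℝ) ^ (-(1 / 2 : ℝ)) := by
    intro p hp
    have hp0 : (0 : ℝ) < p := by exact_mod_cast (ht p hp).pos
    rw [mul_assoc, ← Real.rpow_add hp0]; norm_num [Real.rpow_neg_one]
  rw [Finset.prod_congr rfl hsplit, Finset.prod_mul_distrib]
  have hB : ((∏ p ∈ t, p : ℕ) : ℝ) ^ (-(1 / 2 : ℝ)) = ∏ p ∈ t, (p : ℝ) ^ (-(1 / 2 : ℝ)) := by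
    push_cast
    exact (Real.finsetProd_rpow t (fun p : ℕ ↦ (p : ℝ)) (fun p _ ↦ Nat.cast_nonneg p) _).symm
  rw [hB]
  refine mul_le_mul_of_nonneg_right ?_ (Finset.prod_nonneg fun p _ ↦ by positivity)
  -- small primes contribute at most `15` each, large primes at most `1`
  rw [← Finset.prod_filter_mul_prod_filter_not t (fun p : ℕ ↦ p < 256)]
  have hsmall : ∏ p ∈ t.filter (fun p : ℕ ↦ p < 256), (15 * (p : ℝ) ^ (-(1 / 2 : ℝ))) ≤ (15 : ℝ) ^ 256 := by
    have hcard : (t.filter (fun p : ℕ ↦ p < 256)).card ≤ 256 := by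
      calc (t.filter (fun p : ℕ ↦ p < 256)).card ≤ (Finset.range 256).card :=
            Finset.card_le_card fun p hp ↦ Finset.mem_range.mpr (Finset.mem_filter.mp hp).2
        _ = 256 := Finset.card_range 256
    calc ∏ p ∈ t.filter (fun p : ℕ ↦ p < 256), (15 * (p : ℝ) ^ (-(1 / 2 : ℝ)))
        ≤ ∏ _p ∈ t.filter (fun p : ℕ ↦ p < 256), (15 : ℝ) := by
          refine Finset.prod_le_prod (fun p _ ↦ by positivity) fun p hp ↦ ?_
          have hp1 : (1 : ℝ) ≤ p := by exact_mod_cast (ht p (Finset.mem_filter.mp hp).1).one_lt.le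
          have : (p : ℝ) ^ (-(1 / 2 : ℝ)) ≤ 1 := Real.rpow_le_one_of_one_le_of_nonpos hp1 (by norm_num)
          linarith
      _ = 15 ^ (t.filter (fun p : ℕ ↦ p < 256)).card := Finset.prod_const _
      _ ≤ 15 ^ 256 := pow_le_pow_right₀ (by norm_num) hcard
  have hlarge : ∏ p ∈ t.filter (fun p : ℕ ↦ ¬ p < 256), (15 * (p : ℝ) ^ (-(1 / 2 : ℝ))) ≤ 1 := by
    refine Finset.prod_le_one (fun p _ ↦ by positivity) fun p hp ↦ ?_
    have hp256 : (256 : ℝ) ≤ p := by exact_mod_cast not_lt.mp (Finset.mem_filter.mp hp).2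
    have hp0 : (0 : ℝ) < p := by linarith
    -- `p^{-1/2} ≤ 256^{-1/2} = 1/16`
    have h1 : (p : ℝ) ^ (-(1 / 2 : ℝ)) ≤ (256 : ℝ) ^ (-(1 / 2 : ℝ)) :=
      Real.rpow_le_rpow_of_nonpos (by norm_num) hp256 (by norm_num)
    have h2 : (256 : ℝ) ^ (-(1 / 2 : ℝ)) = 1 / 16 := by
      rw [show (256 : ℝ) = 16 ^ (2 : ℝ) by norm_num, ← Real.rpow_mul (by norm_num)]; norm_num
    rw [h2] at h1
    linarith
  calc _ ≤ (15 : ℝ) ^ 256 * 1 :=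
        mul_le_mul hsmall hlarge (Finset.prod_nonneg fun p _ ↦ by positivity) (by positivity)
    _ = 15 ^ 256 := mul_one _

/-- **`P_ρ⁴ ≤ 15^{256} ∑_{d∣ρ} d^{-1/2}`** (Titchmarsh: `∏(1+1/p)⁴ = O(∑_{n∣ρ} n^{-1/2})`).
[cite: Titchmarsh1986, §10.14] -/
theorem primeProd_pow_four_le_sum_divisors {ρ : ℕ} (hρ : ρ ≠ 0) :
    primeProd ρ ^ 4 ≤ (15 : ℝ) ^ 256 * ∑ d ∈ ρ.divisors, (d : ℝ) ^ (-(1 / 2 : ℝ)) := by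
  have hprime : ∀ p ∈ ρ.primeFactors, p.Prime := fun p hp ↦ Nat.prime_of_mem_primeFactors hp
  refine (primeProd_pow_four_le ρ).trans ?_
  rw [Finset.prod_one_add]
  -- each subset `t` of the prime factors gives the divisor `∏_{p∈t} p`
  set g : Finset ℕ → ℕ := fun t ↦ ∏ p ∈ t, p with hg
  have hinj : Set.InjOn g (ρ.primeFactors.powerset : Set (Finset ℕ)) := by
    intro t₁ ht₁ t₂ ht₂ h
    have h1 : (g t₁).primeFactors = t₁ :=
      Nat.primeFactors_prod fun p hp ↦ hprime p (Finset.mem_powerset.mp ht₁ hp)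
    have h2 : (g t₂).primeFactors = t₂ :=
      Nat.primeFactors_prod fun p hp ↦ hprime p (Finset.mem_powerset.mp ht₂ hp)
    rw [← h1, ← h2, h]
  have hsub : (ρ.primeFactors.powerset).image g ⊆ ρ.divisors := by
    intro d hd
    obtain ⟨t, ht, rfl⟩ := Finset.mem_image.mp hd
    rw [Nat.mem_divisors]
    refine ⟨?_, hρ⟩
    exact (Finset.prod_dvd_prod_of_subset _ _ _ (Finset.mem_powerset.mp ht)).trans (Nat.prod_primeFactors_dvd ρ)
  calc ∑ t ∈ ρ.primeFactors.powerset, ∏ p ∈ t, (15 * (p : ℝ)⁻¹)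
      ≤ ∑ t ∈ ρ.primeFactors.powerset, (15 : ℝ) ^ 256 * ((g t : ℕ) : ℝ) ^ (-(1 / 2 : ℝ)) :=
        Finset.sum_le_sum fun t ht ↦ prod_fifteen_div_le fun p hp ↦ hprime p (Finset.mem_powerset.mp ht hp)
    _ = (15 : ℝ) ^ 256 * ∑ t ∈ ρ.primeFactors.powerset, ((g t : ℕ) : ℝ) ^ (-(1 / 2 : ℝ)) := by
        rw [Finset.mul_sum]
    _ = (15 : ℝ) ^ 256 * ∑ d ∈ (ρ.primeFactors.powerset).image g, (d : ℝ) ^ (-(1 / 2 : ℝ)) := by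
        rw [Finset.sum_image hinj]
    _ ≤ (15 : ℝ) ^ 256 * ∑ d ∈ ρ.divisors, (d : ℝ) ^ (-(1 / 2 : ℝ)) :=
        mul_le_mul_of_nonneg_left (Finset.sum_le_sum_of_subset_of_nonneg hsub fun d _ _ ↦ by positivity)
          (by positivity)

/-- Exchanging `∑_{ρ≤N} ∑_{d∣ρ}`: `∑_{ρ=1}^N ∑_{d∣ρ} F(d, ρ) = ∑_{d=1}^N ∑_{m=1}^{⌊N/d⌋} F(d, dm)`.
[folklore] -/
theorem sum_Icc_sum_divisors_eq (N : ℕ) (F : ℕ → ℕ → ℝ) :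
    ∑ ρ ∈ Finset.Icc 1 N, ∑ d ∈ ρ.divisors, F d ρ =
      ∑ d ∈ Finset.Icc 1 N, ∑ m ∈ Finset.Icc 1 (N / d), F d (d * m) := by
  rw [Finset.sum_sigma', Finset.sum_sigma']
  refine Finset.sum_bij' (fun x _ ↦ ⟨x.2, x.1 / x.2⟩) (fun y _ ↦ ⟨y.1 * y.2, y.1⟩) ?_ ?_ ?_ ?_ ?_
  · intro x hx
    rw [Finset.mem_sigma, Finset.mem_Icc, Nat.mem_divisors] at hx
    obtain ⟨⟨h1, hN⟩, hd, hρ0⟩ := hx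
    have hdpos : 0 < x.2 := Nat.pos_of_dvd_of_pos hd (by omega)
    rw [Finset.mem_sigma, Finset.mem_Icc, Finset.mem_Icc]
    refine ⟨⟨hdpos, le_trans (Nat.le_of_dvd (by omega) hd) hN⟩, ?_, Nat.div_le_div_right hN⟩
    exact Nat.div_pos (Nat.le_of_dvd (by omega) hd) hdpos
  · intro y hy
    rw [Finset.mem_sigma, Finset.mem_Icc, Finset.mem_Icc] at hy
    obtain ⟨⟨h1, hN⟩, hm1, hm⟩ := hy
    rw [Finset.mem_sigma, Finset.mem_Icc, Nat.mem_divisors]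
    refine ⟨⟨Nat.one_le_iff_ne_zero.mpr (mul_ne_zero (by omega) (by omega)), ?_⟩,
      dvd_mul_right _ _, mul_ne_zero (by omega) (by omega)⟩
    exact (Nat.le_div_iff_mul_le (by omega)).mp hm |>.trans' (by rw [mul_comm])
  · intro x hx
    rw [Finset.mem_sigma, Finset.mem_Icc, Nat.mem_divisors] at hx
    obtain ⟨_, hd, _⟩ := hx
    exact Sigma.ext (Nat.mul_div_cancel' hd) (heq_of_eq rfl)
  · intro y hy
    rw [Finset.mem_sigma, Finset.mem_Icc, Finset.mem_Icc] at hy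
    obtain ⟨⟨h1, _⟩, _, _⟩ := hy
    exact Sigma.ext rfl (heq_of_eq (Nat.mul_div_cancel_left _ (by omega)))
  · intro x hx
    rw [Finset.mem_sigma, Finset.mem_Icc, Nat.mem_divisors] at hx
    obtain ⟨_, hd, _⟩ := hx
    simp only [Nat.mul_div_cancel' hd]

/-- `∑_{m=1}^{M} 1/m ≤ 1 + log M`. [folklore] -/
theorem sum_Icc_inv_le_log (M : ℕ) : ∑ m ∈ Finset.Icc 1 M, (m : ℝ)⁻¹ ≤ 1 + Real.log M := by
  induction M with
  | zero => simp
  | succ M ih =>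
    rcases Nat.eq_zero_or_pos M with rfl | hM
    · simp
    rw [Finset.sum_Icc_succ_top (by omega)]
    have hM0 : (0 : ℝ) < M := by exact_mod_cast hM
    have hlog : ((M + 1 : ℕ) : ℝ)⁻¹ ≤ Real.log ((M + 1 : ℕ) : ℝ) - Real.log M := by
      push_cast
      have h := Real.log_le_sub_one_of_pos (show (0 : ℝ) < M / (M + 1) by positivity)
      rw [Real.log_div hM0.ne' (by positivity)] at h
      have : (M : ℝ) / (M + 1) - 1 = -((M : ℝ) + 1)⁻¹ := by field_simp; ring
      rw [this] at h
      linarith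
    linarith

/-- **Average of `P_ρ⁴`**: there is `C` with `∑_{ρ=1}^N ∏_{p∣ρ}(1+1/p)⁴/ρ ≤ C (1 + log N)` for all
`N`. [cite: Titchmarsh1986, §10.14] -/
theorem exists_sum_primeProd_pow_four_div_le :
    ∃ C : ℝ, 0 < C ∧ ∀ N : ℕ, ∑ ρ ∈ Finset.Icc 1 N, primeProd ρ ^ 4 / ρ ≤ C * (1 + Real.log N) := by
  have hsum : Summable fun d : ℕ ↦ (d : ℝ) ^ (-(3 / 2 : ℝ)) := Real.summable_nat_rpow.mpr (by norm_num)
  set Z : ℝ := ∑' d : ℕ, (d : ℝ) ^ (-(3 / 2 : ℝ)) with hZ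
  have hZ0 : 0 ≤ Z := tsum_nonneg fun d ↦ by positivity
  refine ⟨(15 : ℝ) ^ 256 * Z + 1, by positivity, fun N ↦ ?_⟩
  have hlogN : 0 ≤ 1 + Real.log N := by
    have := Real.log_natCast_nonneg N; linarith
  have h1 : ∀ ρ ∈ Finset.Icc 1 N, primeProd ρ ^ 4 / ρ ≤
      ∑ d ∈ ρ.divisors, (15 : ℝ) ^ 256 * ((d : ℝ) ^ (-(1 / 2 : ℝ)) * (ρ : ℝ)⁻¹) := by
    intro ρ hρ
    have hρ0 : ρ ≠ 0 := by have := (Finset.mem_Icc.mp hρ).1; omega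
    rw [div_eq_mul_inv, ← Finset.mul_sum, ← Finset.sum_mul, ← mul_assoc]
    exact mul_le_mul_of_nonneg_right (primeProd_pow_four_le_sum_divisors hρ0) (by positivity)
  calc ∑ ρ ∈ Finset.Icc 1 N, primeProd ρ ^ 4 / ρ
      ≤ ∑ ρ ∈ Finset.Icc 1 N, ∑ d ∈ ρ.divisors, (15 : ℝ) ^ 256 * ((d : ℝ) ^ (-(1 / 2 : ℝ)) * (ρ : ℝ)⁻¹) :=
        Finset.sum_le_sum h1
    _ = ∑ d ∈ Finset.Icc 1 N, ∑ m ∈ Finset.Icc 1 (N / d),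
          (15 : ℝ) ^ 256 * ((d : ℝ) ^ (-(1 / 2 : ℝ)) * ((d * m : ℕ) : ℝ)⁻¹) :=
        sum_Icc_sum_divisors_eq N _
    _ = ∑ d ∈ Finset.Icc 1 N, (15 : ℝ) ^ 256 * (d : ℝ) ^ (-(3 / 2 : ℝ)) *
          ∑ m ∈ Finset.Icc 1 (N / d), (m : ℝ)⁻¹ := by
        refine Finset.sum_congr rfl fun d hd ↦ ?_
        have hd0 : (0 : ℝ) < d := by exact_mod_cast (Finset.mem_Icc.mp hd).1
        rw [Finset.mul_sum]
        refine Finset.sum_congr rfl fun m _ ↦ ?_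
        have : (d : ℝ) ^ (-(3 / 2 : ℝ)) = (d : ℝ) ^ (-(1 / 2 : ℝ)) * (d : ℝ)⁻¹ := by
          rw [← Real.rpow_neg_one, ← Real.rpow_add hd0]; norm_num
        rw [this]; push_cast; rw [mul_inv]; ring
    _ ≤ ∑ d ∈ Finset.Icc 1 N, (15 : ℝ) ^ 256 * (d : ℝ) ^ (-(3 / 2 : ℝ)) * (1 + Real.log N) := by
        refine Finset.sum_le_sum fun d hd ↦ mul_le_mul_of_nonneg_left ?_ (by positivity)
        refine (sum_Icc_inv_le_log (N / d)).trans ?_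
        have hd1 := (Finset.mem_Icc.mp hd).1
        rcases Nat.eq_zero_or_pos (N / d) with h0 | hpos
        · rw [h0]; simp; linarith [Real.log_natCast_nonneg N]
        · have : Real.log ((N / d : ℕ) : ℝ) ≤ Real.log N :=
            Real.log_le_log (by exact_mod_cast hpos) (by exact_mod_cast Nat.div_le_self N d)
          linarith
    _ = (15 : ℝ) ^ 256 * (∑ d ∈ Finset.Icc 1 N, (d : ℝ) ^ (-(3 / 2 : ℝ))) * (1 + Real.log N) := by
        rw [Finset.mul_sum, Finset.sum_mul]
    _ ≤ (15 : ℝ) ^ 256 * Z * (1 + Real.log N) := by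
        gcongr
        exact hsum.sum_le_tsum _ fun d _ ↦ by positivity
    _ ≤ ((15 : ℝ) ^ 256 * Z + 1) * (1 + Real.log N) := by nlinarith

/-! ## §5 Titchmarsh's `y_ρ(θ)` and its factorisation through Lemma 10.12's sums -/

/-- **`y_ρ(θ) = ∑_{κ,ν<X, ρ∣κν} β_κ β_ν κ^{θ-1}/ν`** (the inner sums of `S(θ)`, Titchmarsh §10.11
p. 260). [cite: Titchmarsh1986, §10.11] -/
def yrho (X θ : ℝ) (ρ : ℕ) : ℝ :=
  ∑ p ∈ mollRange X ×ˢ mollRange X,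
    if ρ ∣ p.1 * p.2 then selbergBeta X p.1 * selbergBeta X p.2 * (p.1 : ℝ) ^ (θ - 1) / p.2 else 0

/-- **`β_{dκ'} = α_d α_κ' log(X/(dκ'))/log X`** for coprime `d, κ'` (`X > 1`).
[cite: Titchmarsh1986, §10.11] -/
theorem selbergBeta_mul_of_coprime {X : ℝ} (hX : 1 < X) {d k : ℕ} (hd : d ≠ 0) (hk : k ≠ 0)
    (hcop : d.Coprime k) :
    selbergBeta X (d * k) = selbergAlpha d * selbergAlpha k * Real.log (X / d / k) / Real.log X := by
  have hlog : Real.log X ≠ 0 := (Real.log_pos hX).ne'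
  have hd0 : (d : ℝ) ≠ 0 := Nat.cast_ne_zero.mpr hd
  have hk0 : (k : ℝ) ≠ 0 := Nat.cast_ne_zero.mpr hk
  have hX0 : X ≠ 0 := by linarith
  rw [selbergBeta, selbergAlpha_mul_of_coprime hcop, Nat.cast_mul, Real.log_div (div_ne_zero hX0 hd0) hk0,
    Real.log_div hX0 hd0, Real.log_mul hd0 hk0]
  field_simp
  ring

/-- A `ρ`-smooth number and a number coprime to `ρ` are coprime. [folklore] -/
theorem coprime_of_smooth_of_coprime {ρ d k : ℕ} (hdρ : ∀ p : ℕ, p.Prime → p ∣ d → p ∣ ρ)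
    (hk : k.Coprime ρ) : d.Coprime k :=
  Nat.coprime_of_dvd fun p hp hpd hpk ↦
    (Nat.Prime.coprime_iff_not_dvd hp).mp (Nat.Coprime.coprime_dvd_left hpk hk) (hdρ p hp hpd)

/-- `ρ ∣ (dκ')(d₁ν')` iff `ρ ∣ dd₁` when `(κ'ν', ρ) = 1`. [cite: Titchmarsh1986, §10.11] -/
theorem dvd_mul_mul_iff {ρ d k d₁ k₁ : ℕ} (hk : k.Coprime ρ) (hk₁ : k₁.Coprime ρ) :
    ρ ∣ d * k * (d₁ * k₁) ↔ ρ ∣ d * d₁ := by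
  have hcop : ρ.Coprime (k * k₁) := (Nat.Coprime.mul_left hk hk₁).symm
  rw [show d * k * (d₁ * k₁) = d * d₁ * (k * k₁) by ring]
  exact ⟨fun h ↦ hcop.dvd_of_dvd_mul_right h, fun h ↦ h.mul_right _⟩

/-- `mollLog` as a sum over `copRange`. [folklore] -/
theorem mollLog_eq_sum_copRange (θ Y : ℝ) (ρ : ℕ) :
    mollLog θ Y ρ = ∑ k ∈ copRange ρ Y, selbergAlpha k * (k : ℝ) ^ (θ - 1) * Real.log (Y / k) := by
  rw [mollLog, copRange, Finset.sum_filter]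

/-- The summand of `y_ρ` at `κ = dκ'`, `ν = d₁ν'`. [cite: Titchmarsh1986, §10.11] -/
theorem yrho_summand_eq {X θ : ℝ} (hX : 1 < X) {ρ d k d₁ k₁ : ℕ} (hd : d ∈ smoothRange ρ X)
    (hk : k ∈ copRange ρ (X / d)) (hd₁ : d₁ ∈ smoothRange ρ X) (hk₁ : k₁ ∈ copRange ρ (X / d₁)) :
    (if ρ ∣ d * k * (d₁ * k₁) then selbergBeta X (d * k) * selbergBeta X (d₁ * k₁) *
        ((d * k : ℕ) : ℝ) ^ (θ - 1) / ((d₁ * k₁ : ℕ) : ℝ) else 0) =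
      (Real.log X)⁻¹ ^ 2 *
        ((if ρ ∣ d * d₁ then selbergAlpha d * selbergAlpha d₁ * (d : ℝ) ^ (θ - 1) / d₁ else 0) *
          ((selbergAlpha k * (k : ℝ) ^ (θ - 1) * Real.log (X / d / k)) *
            (selbergAlpha k₁ * (k₁ : ℝ) ^ ((0 : ℝ) - 1) * Real.log (X / d₁ / k₁)))) := by
  obtain ⟨⟨hd1, _⟩, hdρ⟩ := mem_smoothRange.mp hd
  obtain ⟨⟨hd₁1, _⟩, hd₁ρ⟩ := mem_smoothRange.mp hd₁
  obtain ⟨⟨hk1, _⟩, hkρ⟩ := mem_copRange.mp hk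
  obtain ⟨⟨hk₁1, _⟩, hk₁ρ⟩ := mem_copRange.mp hk₁
  have hiff := dvd_mul_mul_iff (d := d) (d₁ := d₁) hkρ hk₁ρ
  by_cases hdiv : ρ ∣ d * d₁
  · rw [if_pos (hiff.mpr hdiv), if_pos hdiv,
      selbergBeta_mul_of_coprime hX (by omega) (by omega) (coprime_of_smooth_of_coprime hdρ hkρ),
      selbergBeta_mul_of_coprime hX (by omega) (by omega) (coprime_of_smooth_of_coprime hd₁ρ hk₁ρ)]
    have hlog : Real.log X ≠ 0 := (Real.log_pos hX).ne'
    have hdpos : (0 : ℝ) < d := by exact_mod_cast hd1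
    have hkpos : (0 : ℝ) < k := by exact_mod_cast hk1
    have hd₁pos : (0 : ℝ) < d₁ := by exact_mod_cast hd₁1
    have hk₁pos : (0 : ℝ) < k₁ := by exact_mod_cast hk₁1
    have hpow : ((d * k : ℕ) : ℝ) ^ (θ - 1) = (d : ℝ) ^ (θ - 1) * (k : ℝ) ^ (θ - 1) := by
      push_cast; exact Real.mul_rpow hdpos.le hkpos.le
    have hk₁pow : (k₁ : ℝ) ^ ((0 : ℝ) - 1) = (k₁ : ℝ)⁻¹ := by
      rw [zero_sub, Real.rpow_neg_one]
    rw [hpow, hk₁pow]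
    push_cast
    field_simp
  · rw [if_neg (fun h ↦ hdiv (hiff.mp h)), if_neg hdiv]; ring

/-- **Factorisation of `y_ρ(θ)`** (Titchmarsh p. 260):
`y_ρ(θ) = (log X)^{-2} ∑_{d,d₁ ρ-smooth, ρ∣dd₁} α_dα_{d₁} d^{θ-1}d₁^{-1} L_θ(X/d) L_0(X/d₁)` with
`L_θ(Y) = ∑_{κ'<Y,(κ',ρ)=1} α_κ' κ'^{θ-1} log(Y/κ')` (`mollLog`). [cite: Titchmarsh1986, §10.11] -/
theorem yrho_eq {X θ : ℝ} (hX : 1 < X) (ρ : ℕ) :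
    yrho X θ ρ = (Real.log X)⁻¹ ^ 2 *
      ∑ d ∈ smoothRange ρ X, ∑ d₁ ∈ smoothRange ρ X,
        (if ρ ∣ d * d₁ then selbergAlpha d * selbergAlpha d₁ * (d : ℝ) ^ (θ - 1) / d₁ else 0) *
          (mollLog θ (X / d) ρ * mollLog 0 (X / d₁) ρ) := by
  rw [yrho, Finset.sum_product]
  -- reindex `κ`, then `ν`
  rw [sum_mollRange_eq_sum_rhoPart ρ X]
  have hinner : ∀ d ∈ smoothRange ρ X, ∀ k ∈ copRange ρ (X / d),
      ∑ ν ∈ mollRange X, (if ρ ∣ d * k * ν then selbergBeta X (d * k) * selbergBeta X ν *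
          ((d * k : ℕ) : ℝ) ^ (θ - 1) / ν else 0) =
        ∑ d₁ ∈ smoothRange ρ X, ∑ k₁ ∈ copRange ρ (X / d₁),
          (Real.log X)⁻¹ ^ 2 *
            ((if ρ ∣ d * d₁ then selbergAlpha d * selbergAlpha d₁ * (d : ℝ) ^ (θ - 1) / d₁ else 0) *
              ((selbergAlpha k * (k : ℝ) ^ (θ - 1) * Real.log (X / d / k)) *
                (selbergAlpha k₁ * (k₁ : ℝ) ^ ((0 : ℝ) - 1) * Real.log (X / d₁ / k₁)))) := by
    intro d hd k hk
    rw [sum_mollRange_eq_sum_rhoPart ρ X]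
    refine Finset.sum_congr rfl fun d₁ hd₁ ↦ Finset.sum_congr rfl fun k₁ hk₁ ↦ ?_
    exact yrho_summand_eq hX hd hk hd₁ hk₁
  rw [Finset.sum_congr rfl fun d hd ↦ Finset.sum_congr rfl fun k hk ↦ hinner d hd k hk]
  -- swap the `k` and `d₁` sums and factor
  rw [Finset.mul_sum]
  refine Finset.sum_congr rfl fun d hd ↦ ?_
  rw [Finset.sum_comm, Finset.mul_sum]
  refine Finset.sum_congr rfl fun d₁ hd₁ ↦ ?_
  rw [mollLog_eq_sum_copRange, mollLog_eq_sum_copRange, Finset.sum_mul_sum, Finset.mul_sum, Finset.mul_sum]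
  refine Finset.sum_congr rfl fun k hk ↦ ?_
  rw [Finset.mul_sum, Finset.mul_sum]

/-! ## §6 Lemma 10.13: `∑_{ρ∣dd₁} |α_dα_{d₁}|/(dd₁) ≤ 2 ∏_{p∣ρ}(1+1/p)/ρ` -/

/-- `n ↦ 1/n` as a monoid homomorphism `ℕ →* ℝ`. [folklore] -/
def invHom : ℕ →* ℝ where
  toFun n := (n : ℝ)⁻¹
  map_one' := by simp
  map_mul' m n := by push_cast; rw [mul_inv]

/-- `∑_{E ρ-smooth} 1/E = ∏_{p∣ρ}(1 - 1/p)⁻¹`. [folklore] -/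
theorem hasSum_inv_factoredNumbers (ρ : ℕ) :
    HasSum (fun m : Nat.factoredNumbers ρ.primeFactors ↦ ((m : ℕ) : ℝ)⁻¹)
      (∏ p ∈ ρ.primeFactors, (1 - (p : ℝ)⁻¹)⁻¹) := by
  have h := EulerProduct.summable_and_hasSum_factoredNumbers_prod_filter_prime_geometric (f := invHom)
    (fun {p} hp ↦ by
      change ‖((p : ℝ))⁻¹‖ < 1
      rw [norm_inv, Real.norm_natCast]
      exact inv_lt_one_of_one_lt₀ (by exact_mod_cast hp.one_lt)) ρ.primeFactors
  have hfilter : ρ.primeFactors.filter Nat.Prime = ρ.primeFactors :=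
    Finset.filter_true_of_mem fun p hp ↦ Nat.prime_of_mem_primeFactors hp
  rw [hfilter] at h
  exact h.2

/-- A finite sum of `1/E` over `ρ`-smooth numbers is at most `2 ∏_{p∣ρ}(1+1/p)`. [folklore] -/
theorem sum_inv_smooth_le {ρ : ℕ} (u : Finset ℕ) (hu : ∀ E ∈ u, E ≠ 0 ∧ E.primeFactors ⊆ ρ.primeFactors) :
    ∑ E ∈ u, (E : ℝ)⁻¹ ≤ 2 * primeProd ρ := by
  have hmem : ∀ E ∈ u, E ∈ Nat.factoredNumbers ρ.primeFactors := fun E hE ↦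
    Nat.mem_factoredNumbers_iff_primeFactors_subset.mpr (hu E hE)
  have h1 : ∑ x ∈ u.subtype (· ∈ Nat.factoredNumbers ρ.primeFactors), ((x : ℕ) : ℝ)⁻¹ = ∑ E ∈ u, (E : ℝ)⁻¹ := by
    rw [Finset.sum_subtype_eq_sum_filter (f := fun E : ℕ ↦ (E : ℝ)⁻¹), Finset.filter_true_of_mem hmem]
  rw [← h1]
  refine (sum_le_hasSum _ (fun x _ ↦ by positivity) (hasSum_inv_factoredNumbers ρ)).trans ?_
  have h2 := prod_one_sub_rpow_inv_le ρ (σ := 1) le_rfl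
  simp only [Real.rpow_neg_one] at h2
  rw [Finset.prod_inv_distrib]
  exact h2

/-- **Titchmarsh's Lemma 10.13** (with `|α|∗|α| ≤ 1` in place of `∑ α'_d α'_{d₁} = 1`): for `ρ ≥ 1`,
`∑_{d,d₁ ρ-smooth, ρ∣dd₁} |α_d α_{d₁}|/(dd₁) ≤ 2 ∏_{p∣ρ}(1+1/p)/ρ`
(Titchmarsh: `= O(ρ⁻¹∏_{p∣ρ}(1+1/p))`). [cite: Titchmarsh1986, Lemma 10.13] -/
theorem sum_smooth_abs_alpha_le {X : ℝ} {ρ : ℕ} (hρ : ρ ≠ 0) :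
    ∑ d ∈ smoothRange ρ X, ∑ d₁ ∈ smoothRange ρ X,
      (if ρ ∣ d * d₁ then |selbergAlpha d| * |selbergAlpha d₁| / ((d : ℝ) * d₁) else 0) ≤
      2 * primeProd ρ / ρ := by
  classical
  set s := smoothRange ρ X ×ˢ smoothRange ρ X with hs
  set g : ℕ × ℕ → ℕ := fun x ↦ x.1 * x.2 with hg
  set t := s.image g with ht
  have hmaps : ∀ x ∈ s, g x ∈ t := fun x hx ↦ Finset.mem_image_of_mem g hx
  rw [← Finset.sum_product (f := fun x : ℕ × ℕ ↦
    if ρ ∣ x.1 * x.2 then |selbergAlpha x.1| * |selbergAlpha x.2| / ((x.1 : ℝ) * x.2) else 0)]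
  rw [← Finset.sum_fiberwise_of_maps_to hmaps]
  -- each fibre `{dd₁ = D}` contributes at most `[ρ ∣ D]/D`
  have hfib : ∀ D ∈ t, ∑ x ∈ s with g x = D,
      (if ρ ∣ x.1 * x.2 then |selbergAlpha x.1| * |selbergAlpha x.2| / ((x.1 : ℝ) * x.2) else 0) ≤
        if ρ ∣ D then (D : ℝ)⁻¹ else 0 := by
    intro D hD
    obtain ⟨x₀, hx₀, rfl⟩ := Finset.mem_image.mp hD
    have hx₀1 : x₀.1 ≠ 0 := by
      have := (mem_smoothRange.mp (Finset.mem_product.mp hx₀).1).1.1; omega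
    have hx₀2 : x₀.2 ≠ 0 := by
      have := (mem_smoothRange.mp (Finset.mem_product.mp hx₀).2).1.1; omega
    have hD0 : g x₀ ≠ 0 := mul_ne_zero hx₀1 hx₀2
    by_cases hdiv : ρ ∣ g x₀
    · rw [if_pos hdiv]
      calc ∑ x ∈ s with g x = g x₀,
            (if ρ ∣ x.1 * x.2 then |selbergAlpha x.1| * |selbergAlpha x.2| / ((x.1 : ℝ) * x.2) else 0)
          = ∑ x ∈ s with g x = g x₀, |selbergAlpha x.1| * |selbergAlpha x.2| * ((g x₀ : ℕ) : ℝ)⁻¹ := by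
            refine Finset.sum_congr rfl fun x hx ↦ ?_
            have hxg : g x = g x₀ := (Finset.mem_filter.mp hx).2
            rw [show x.1 * x.2 = g x from rfl, hxg, if_pos hdiv, div_eq_mul_inv]
            congr 1
            rw [← hxg, hg]
            push_cast
            rfl
        _ = (∑ x ∈ s with g x = g x₀, |selbergAlpha x.1| * |selbergAlpha x.2|) * ((g x₀ : ℕ) : ℝ)⁻¹ := by
            rw [Finset.sum_mul]
        _ ≤ (∑ x ∈ (g x₀).divisorsAntidiagonal, |selbergAlpha x.1| * |selbergAlpha x.2|) *
              ((g x₀ : ℕ) : ℝ)⁻¹ := by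
            refine mul_le_mul_of_nonneg_right ?_ (by positivity)
            refine Finset.sum_le_sum_of_subset_of_nonneg (fun x hx ↦ ?_) fun x _ _ ↦ by positivity
            rw [Nat.mem_divisorsAntidiagonal]
            exact ⟨(Finset.mem_filter.mp hx).2, hD0⟩
        _ ≤ 1 * ((g x₀ : ℕ) : ℝ)⁻¹ :=
            mul_le_mul_of_nonneg_right (sum_divisorsAntidiagonal_abs_alpha_le_one _) (by positivity)
        _ = ((g x₀ : ℕ) : ℝ)⁻¹ := one_mul _
    · rw [if_neg hdiv]
      refine le_of_eq (Finset.sum_eq_zero fun x hx ↦ ?_)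
      have hxg : g x = g x₀ := (Finset.mem_filter.mp hx).2
      rw [show x.1 * x.2 = g x from rfl, hxg, if_neg hdiv]
  refine (Finset.sum_le_sum hfib).trans ?_
  rw [← Finset.sum_filter]
  -- `∑_{D ∈ t, ρ ∣ D} 1/D = ρ⁻¹ ∑_{E} 1/E` over the `ρ`-smooth numbers `E = D/ρ`
  set t' := t.filter (fun D ↦ ρ ∣ D) with ht'
  have hsmooth : ∀ D ∈ t, D ≠ 0 ∧ D.primeFactors ⊆ ρ.primeFactors := by
    intro D hD
    obtain ⟨x, hx, rfl⟩ := Finset.mem_image.mp hD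
    obtain ⟨hx1, hx2⟩ := Finset.mem_product.mp hx
    obtain ⟨⟨h1, _⟩, h1ρ⟩ := mem_smoothRange.mp hx1
    obtain ⟨⟨h2, _⟩, h2ρ⟩ := mem_smoothRange.mp hx2
    have hx10 : x.1 ≠ 0 := by omega
    have hx20 : x.2 ≠ 0 := by omega
    refine ⟨mul_ne_zero hx10 hx20, fun p hp ↦ ?_⟩
    have hp' := Nat.prime_of_mem_primeFactors hp
    have hpd := Nat.dvd_of_mem_primeFactors hp
    rcases (Nat.Prime.dvd_mul hp').mp hpd with h | h
    · exact Nat.mem_primeFactors.mpr ⟨hp', h1ρ p hp' h, hρ⟩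
    · exact Nat.mem_primeFactors.mpr ⟨hp', h2ρ p hp' h, hρ⟩
  have hinj : Set.InjOn (fun D ↦ D / ρ) (t' : Set ℕ) := by
    intro D₁ hD₁ D₂ hD₂ h
    have h1 := (Finset.mem_filter.mp (Finset.mem_coe.mp hD₁)).2
    have h2 := (Finset.mem_filter.mp (Finset.mem_coe.mp hD₂)).2
    rw [← Nat.mul_div_cancel' h1, ← Nat.mul_div_cancel' h2]
    simp only at h
    rw [h]
  have hρpos : (0 : ℝ) < ρ := by exact_mod_cast Nat.pos_of_ne_zero hρ
  calc ∑ D ∈ t', (D : ℝ)⁻¹ = ∑ D ∈ t', (ρ : ℝ)⁻¹ * ((D / ρ : ℕ) : ℝ)⁻¹ := by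
        refine Finset.sum_congr rfl fun D hD ↦ ?_
        have hdiv := (Finset.mem_filter.mp hD).2
        rw [← mul_inv]
        congr 1
        exact_mod_cast (Nat.mul_div_cancel' hdiv).symm
    _ = (ρ : ℝ)⁻¹ * ∑ E ∈ t'.image (fun D ↦ D / ρ), (E : ℝ)⁻¹ := by
        rw [Finset.mul_sum, Finset.sum_image hinj]
    _ ≤ (ρ : ℝ)⁻¹ * (2 * primeProd ρ) := by
        refine mul_le_mul_of_nonneg_left (sum_inv_smooth_le _ fun E hE ↦ ?_) (by positivity)
        obtain ⟨D, hD, rfl⟩ := Finset.mem_image.mp hE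
        obtain ⟨hDt, hdiv⟩ := Finset.mem_filter.mp hD
        obtain ⟨hD0, hDsub⟩ := hsmooth D hDt
        refine ⟨?_, (Nat.primeFactors_mono (Nat.div_dvd_of_dvd hdiv) hD0).trans hDsub⟩
        exact (Nat.div_ne_zero_iff_of_dvd hdiv).mpr ⟨hD0, hρ⟩
    _ = 2 * primeProd ρ / ρ := by ring

/-! ## §7 `S(θ)` and the identity `S(θ) = ∑_ρ φ_{1-θ}(ρ) y_ρ(θ)²` -/

/-- **Titchmarsh's quadratic form** `S(θ) = ∑_{κλμν} (q/κμ)^{1-θ} β_κβ_λβ_μβ_ν/(λν)`, `q = (κν, λμ)`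
(§10.11, (10.11.1)); here indexed by the pairs `p = (κ, ν)`, `p' = (μ, λ)`.
[cite: Titchmarsh1986, §10.11] -/
def Squad (X θ : ℝ) : ℝ :=
  ∑ p ∈ mollRange X ×ˢ mollRange X, ∑ p' ∈ mollRange X ×ˢ mollRange X,
    ((Nat.gcd (p.1 * p.2) (p'.1 * p'.2) : ℝ) / ((p.1 : ℝ) * p'.1)) ^ (1 - θ) *
      (selbergBeta X p.1 * selbergBeta X p.2 * selbergBeta X p'.1 * selbergBeta X p'.2) / ((p.2 : ℝ) * p'.2)

/-- `∑_{1≤ρ≤N, ρ∣a, ρ∣b} φ_s(ρ) = gcd(a,b)^s` when `1 ≤ a ≤ N`. [cite: Titchmarsh1986, §10.11] -/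
theorem sum_Icc_phiPow_dvd_dvd {s : ℝ} {N a b : ℕ} (ha : a ≠ 0) (haN : a ≤ N) :
    ∑ ρ ∈ Finset.Icc 1 N, (if ρ ∣ a ∧ ρ ∣ b then phiPow s ρ else 0) = ((Nat.gcd a b : ℕ) : ℝ) ^ s := by
  have hg0 : Nat.gcd a b ≠ 0 := Nat.gcd_ne_zero_left ha
  rw [← Finset.sum_filter, ← sum_divisors_phiPow hg0]
  congr 1
  ext ρ
  rw [Finset.mem_filter, Finset.mem_Icc, Nat.mem_divisors, Nat.dvd_gcd_iff]
  constructor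
  · rintro ⟨-, h⟩; exact ⟨h, hg0⟩
  · rintro ⟨h, -⟩
    have hρa : ρ ∣ a := h.1
    have hρ0 : ρ ≠ 0 := fun h0 ↦ ha (by rw [h0] at hρa; exact Nat.eq_zero_of_zero_dvd hρa)
    exact ⟨⟨Nat.one_le_iff_ne_zero.mpr hρ0, (Nat.le_of_dvd (Nat.pos_of_ne_zero ha) hρa).trans haN⟩, h⟩

/-- **`S(θ) = ∑_ρ φ_{1-θ}(ρ) y_ρ(θ)²`** (Titchmarsh §10.11: "`S(θ) = ∑_ρ φ_{-θ}(ρ) (∑_{ρ∣κν} β_κβ_ν/(κ^{1-θ}ν))²`").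
[cite: Titchmarsh1986, §10.11] -/
theorem Squad_eq_sum_phiPow_mul_sq {X θ : ℝ} {N : ℕ}
    (hN : ∀ p ∈ mollRange X ×ˢ mollRange X, p.1 * p.2 ≤ N) :
    Squad X θ = ∑ ρ ∈ Finset.Icc 1 N, phiPow (1 - θ) ρ * yrho X θ ρ ^ 2 := by
  set R := mollRange X ×ˢ mollRange X with hR
  set f : ℕ → ℕ × ℕ → ℝ := fun ρ p ↦
    if ρ ∣ p.1 * p.2 then selbergBeta X p.1 * selbergBeta X p.2 * (p.1 : ℝ) ^ (θ - 1) / p.2 else 0 with hf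
  have hy : ∀ ρ, yrho X θ ρ = ∑ p ∈ R, f ρ p := fun ρ ↦ rfl
  -- right-hand side as a triple sum
  have hrhs : ∑ ρ ∈ Finset.Icc 1 N, phiPow (1 - θ) ρ * yrho X θ ρ ^ 2 =
      ∑ ρ ∈ Finset.Icc 1 N, ∑ p ∈ R, ∑ p' ∈ R, phiPow (1 - θ) ρ * (f ρ p * f ρ p') := by
    refine Finset.sum_congr rfl fun ρ _ ↦ ?_
    rw [hy, sq, Finset.sum_mul_sum, Finset.mul_sum]
    refine Finset.sum_congr rfl fun p _ ↦ ?_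
    rw [Finset.mul_sum]
  rw [hrhs, Finset.sum_comm]
  refine Finset.sum_congr rfl fun p hp ↦ ?_
  rw [Finset.sum_comm]
  refine Finset.sum_congr rfl fun p' hp' ↦ ?_
  -- the summand identity for fixed `p, p'`
  obtain ⟨hp1, hp2⟩ := Finset.mem_product.mp hp
  obtain ⟨hp'1, hp'2⟩ := Finset.mem_product.mp hp'
  have hκ := (mem_mollRange.mp hp1).1
  have hν := (mem_mollRange.mp hp2).1
  have hμ := (mem_mollRange.mp hp'1).1
  have hl := (mem_mollRange.mp hp'2).1
  have hκ0 : (0 : ℝ) < p.1 := by exact_mod_cast hκ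
  have hμ0 : (0 : ℝ) < p'.1 := by exact_mod_cast hμ
  have ha : p.1 * p.2 ≠ 0 := mul_ne_zero (by omega) (by omega)
  have hsum : ∑ ρ ∈ Finset.Icc 1 N, phiPow (1 - θ) ρ * (f ρ p * f ρ p') =
      (∑ ρ ∈ Finset.Icc 1 N, (if ρ ∣ p.1 * p.2 ∧ ρ ∣ p'.1 * p'.2 then phiPow (1 - θ) ρ else 0)) *
        (selbergBeta X p.1 * selbergBeta X p.2 * (p.1 : ℝ) ^ (θ - 1) / p.2 *
          (selbergBeta X p'.1 * selbergBeta X p'.2 * (p'.1 : ℝ) ^ (θ - 1) / p'.2)) := by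
    rw [Finset.sum_mul]
    refine Finset.sum_congr rfl fun ρ _ ↦ ?_
    simp only [hf]
    by_cases h1 : ρ ∣ p.1 * p.2 <;> by_cases h2 : ρ ∣ p'.1 * p'.2 <;> simp [h1, h2]
  rw [hsum, sum_Icc_phiPow_dvd_dvd ha (hN p hp)]
  have hgcd : (((Nat.gcd (p.1 * p.2) (p'.1 * p'.2) : ℕ) : ℝ) / ((p.1 : ℝ) * p'.1)) ^ (1 - θ) =
      ((Nat.gcd (p.1 * p.2) (p'.1 * p'.2) : ℕ) : ℝ) ^ (1 - θ) * ((p.1 : ℝ) ^ (θ - 1) * (p'.1 : ℝ) ^ (θ - 1)) := by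
    rw [Real.div_rpow (by positivity) (by positivity), Real.mul_rpow hκ0.le hμ0.le, div_eq_mul_inv, mul_inv,
      ← Real.rpow_neg hκ0.le, ← Real.rpow_neg hμ0.le, neg_sub]
  rw [hgcd]
  ring

/-- `S(θ) ≥ 0` for `θ ≤ 1`. [folklore] -/
theorem Squad_nonneg {X θ : ℝ} (hθ : θ ≤ 1) : 0 ≤ Squad X θ := by
  obtain ⟨N, hN⟩ : ∃ N : ℕ, ∀ p ∈ mollRange X ×ˢ mollRange X, p.1 * p.2 ≤ N :=
    ⟨(mollRange X ×ˢ mollRange X).sup fun p ↦ p.1 * p.2, fun p hp ↦ Finset.le_sup (f := fun p ↦ p.1 * p.2) hp⟩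
  rw [Squad_eq_sum_phiPow_mul_sq hN]
  exact Finset.sum_nonneg fun ρ _ ↦ mul_nonneg (phiPow_nonneg (by linarith) ρ) (sq_nonneg _)

/-! ## §8 Lemma 10.14 -/

/-- **Bound for `y_ρ(θ)`** (Titchmarsh p. 262, display before "Hence"): there is an absolute `C` with
`|y_ρ(θ)| ≤ C X^θ ∏_{p∣ρ}(1+1/p)² / (ρ log X)` for `X ≥ 3`, `θ ≥ 0`, `ρ ≥ 1`.
[cite: Titchmarsh1986, §10.14] -/
theorem abs_yrho_le :
    ∃ C : ℝ, 0 < C ∧ ∀ X : ℝ, 3 ≤ X → ∀ θ : ℝ, 0 ≤ θ → ∀ ρ : ℕ, ρ ≠ 0 →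
      |yrho X θ ρ| ≤ C * X ^ θ * primeProd ρ ^ 2 / (ρ * Real.log X) := by
  obtain ⟨C, hC, hL⟩ := abs_mollLog_le
  refine ⟨4 * C ^ 2, by positivity, fun X hX θ hθ ρ hρ ↦ ?_⟩
  have hX1 : 1 < X := by linarith
  have hX0 : 0 < X := by linarith
  have hlog1 : 1 ≤ Real.log X := by
    rw [Real.le_log_iff_exp_le hX0]
    have := Real.exp_one_lt_d9; linarith
  have hlog0 : 0 < Real.log X := by linarith
  set P := primeProd ρ with hP
  have hP1 : 1 ≤ P := one_le_primeProd ρ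
  -- termwise bound inside `yrho_eq`
  have hterm : ∀ d ∈ smoothRange ρ X, ∀ d₁ ∈ smoothRange ρ X,
      |(if ρ ∣ d * d₁ then selbergAlpha d * selbergAlpha d₁ * (d : ℝ) ^ (θ - 1) / d₁ else 0) *
          (mollLog θ (X / d) ρ * mollLog 0 (X / d₁) ρ)| ≤
        (C ^ 2 * X ^ θ * (1 + Real.log X) * P) *
          (if ρ ∣ d * d₁ then |selbergAlpha d| * |selbergAlpha d₁| / ((d : ℝ) * d₁) else 0) := by
    intro d hd d₁ hd₁
    obtain ⟨⟨hd1, hdX⟩, _⟩ := mem_smoothRange.mp hd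
    obtain ⟨⟨hd₁1, hd₁X⟩, _⟩ := mem_smoothRange.mp hd₁
    have hdpos : (0 : ℝ) < d := by exact_mod_cast hd1
    have hd₁pos : (0 : ℝ) < d₁ := by exact_mod_cast hd₁1
    by_cases hdiv : ρ ∣ d * d₁
    · rw [if_pos hdiv, if_pos hdiv]
      have hY : 1 ≤ X / d := by rw [le_div_iff₀ hdpos]; linarith
      have hY₁ : 1 ≤ X / d₁ := by rw [le_div_iff₀ hd₁pos]; linarith
      have h1 := hL ρ hρ θ hθ (X / d) hY
      have h2 := hL ρ hρ 0 le_rfl (X / d₁) hY₁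
      rw [Real.rpow_zero, mul_one] at h2
      have hd1' : (1 : ℝ) ≤ d := by exact_mod_cast hd1
      have hd₁1' : (1 : ℝ) ≤ d₁ := by exact_mod_cast hd₁1
      have hXd : X / d ≤ X := div_le_self hX0.le hd1'
      have hXd₁ : X / d₁ ≤ X := div_le_self hX0.le hd₁1'
      have hlogd : Real.sqrt (1 + Real.log (X / d)) ≤ Real.sqrt (1 + Real.log X) :=
        Real.sqrt_le_sqrt (by linarith [Real.log_le_log (by positivity) hXd])
      have hlogd₁ : Real.sqrt (1 + Real.log (X / d₁)) ≤ Real.sqrt (1 + Real.log X) :=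
        Real.sqrt_le_sqrt (by linarith [Real.log_le_log (by positivity) hXd₁])
      have hsP : 0 ≤ Real.sqrt P := Real.sqrt_nonneg _
      have hPdef : ∏ p ∈ ρ.primeFactors, (1 + (p : ℝ)⁻¹) = P := by rw [hP]; rfl
      rw [hPdef] at h1 h2
      have hb1 : |mollLog θ (X / d) ρ| ≤ C * (X / d) ^ θ * Real.sqrt (1 + Real.log X) * Real.sqrt P := by
        refine h1.trans ?_; gcongr
      have hb2 : |mollLog 0 (X / d₁) ρ| ≤ C * Real.sqrt (1 + Real.log X) * Real.sqrt P := by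
        refine h2.trans ?_; gcongr
      have hXd : (X / d) ^ θ = X ^ θ * (d : ℝ) ^ (-θ) := by
        rw [Real.div_rpow hX0.le hdpos.le, Real.rpow_neg hdpos.le, div_eq_mul_inv]
      have hdd : (d : ℝ) ^ (θ - 1) * (d : ℝ) ^ (-θ) = (d : ℝ)⁻¹ := by
        rw [← Real.rpow_add hdpos, ← Real.rpow_neg_one]; ring_nf
      rw [abs_mul, abs_mul, abs_div, abs_mul, abs_mul, abs_of_pos (Real.rpow_pos_of_pos hdpos _),
        abs_of_pos hd₁pos]
      have hsq : Real.sqrt (1 + Real.log X) * Real.sqrt (1 + Real.log X) = 1 + Real.log X :=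
        Real.mul_self_sqrt (by linarith)
      have hsqP : Real.sqrt P * Real.sqrt P = P := Real.mul_self_sqrt (by linarith)
      calc |selbergAlpha d| * |selbergAlpha d₁| * (d : ℝ) ^ (θ - 1) / d₁ *
            (|mollLog θ (X / d) ρ| * |mollLog 0 (X / d₁) ρ|)
          ≤ |selbergAlpha d| * |selbergAlpha d₁| * (d : ℝ) ^ (θ - 1) / d₁ *
            ((C * (X / d) ^ θ * Real.sqrt (1 + Real.log X) * Real.sqrt P) *
              (C * Real.sqrt (1 + Real.log X) * Real.sqrt P)) := by
            refine mul_le_mul_of_nonneg_left (mul_le_mul hb1 hb2 (abs_nonneg _) (by positivity)) (by positivity)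
        _ = C ^ 2 * X ^ θ * (Real.sqrt (1 + Real.log X) * Real.sqrt (1 + Real.log X)) *
              (Real.sqrt P * Real.sqrt P) *
              (|selbergAlpha d| * |selbergAlpha d₁| * ((d : ℝ) ^ (θ - 1) * (d : ℝ) ^ (-θ)) / d₁) := by
            rw [hXd]; ring
        _ = _ := by rw [hsq, hsqP, hdd]; ring
    · rw [if_neg hdiv, if_neg hdiv]; simp
  have hT := sum_smooth_abs_alpha_le (X := X) hρ
  rw [yrho_eq hX1, abs_mul, abs_of_nonneg (by positivity : (0 : ℝ) ≤ (Real.log X)⁻¹ ^ 2)]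
  have hρpos : (0 : ℝ) < ρ := by exact_mod_cast Nat.pos_of_ne_zero hρ
  calc (Real.log X)⁻¹ ^ 2 * |∑ d ∈ smoothRange ρ X, ∑ d₁ ∈ smoothRange ρ X,
          (if ρ ∣ d * d₁ then selbergAlpha d * selbergAlpha d₁ * (d : ℝ) ^ (θ - 1) / d₁ else 0) *
            (mollLog θ (X / d) ρ * mollLog 0 (X / d₁) ρ)|
      ≤ (Real.log X)⁻¹ ^ 2 * ∑ d ∈ smoothRange ρ X, ∑ d₁ ∈ smoothRange ρ X,
          (C ^ 2 * X ^ θ * (1 + Real.log X) * P) *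
            (if ρ ∣ d * d₁ then |selbergAlpha d| * |selbergAlpha d₁| / ((d : ℝ) * d₁) else 0) := by
        refine mul_le_mul_of_nonneg_left ?_ (by positivity)
        refine (Finset.abs_sum_le_sum_abs _ _).trans (Finset.sum_le_sum fun d hd ↦ ?_)
        exact (Finset.abs_sum_le_sum_abs _ _).trans (Finset.sum_le_sum fun d₁ hd₁ ↦ hterm d hd d₁ hd₁)
    _ = (Real.log X)⁻¹ ^ 2 * ((C ^ 2 * X ^ θ * (1 + Real.log X) * P) *
          ∑ d ∈ smoothRange ρ X, ∑ d₁ ∈ smoothRange ρ X,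
            (if ρ ∣ d * d₁ then |selbergAlpha d| * |selbergAlpha d₁| / ((d : ℝ) * d₁) else 0)) := by
        congr 1
        rw [Finset.mul_sum]
        exact Finset.sum_congr rfl fun d _ ↦ by rw [Finset.mul_sum]
    _ ≤ (Real.log X)⁻¹ ^ 2 * ((C ^ 2 * X ^ θ * (1 + Real.log X) * P) * (2 * P / ρ)) :=
        mul_le_mul_of_nonneg_left (mul_le_mul_of_nonneg_left hT (by positivity)) (by positivity)
    _ = (C ^ 2 * X ^ θ * P ^ 2 / (ρ * Real.log X)) * (2 * (1 + Real.log X) / Real.log X) := by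
        field_simp
    _ ≤ (C ^ 2 * X ^ θ * P ^ 2 / (ρ * Real.log X)) * 4 := by
        refine mul_le_mul_of_nonneg_left ?_ (by positivity)
        rw [div_le_iff₀ hlog0]; linarith
    _ = 4 * C ^ 2 * X ^ θ * primeProd ρ ^ 2 / (ρ * Real.log X) := by rw [hP]; ring

/-- **Titchmarsh's Lemma 10.14**: `S(θ) = O(X^{2θ}/log X)` uniformly in `θ`: there is an absolute
`C` with `0 ≤ S(θ) ≤ C X^{2θ}/log X` for all `X ≥ 3` and `0 ≤ θ ≤ 1` (Titchmarsh: `0 ≤ θ ≤ ½`; in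
particular `S(0) = O(1/log X)`). [cite: Titchmarsh1986, Lemma 10.14] -/
theorem Squad_le :
    ∃ C : ℝ, 0 < C ∧ ∀ X : ℝ, 3 ≤ X → ∀ θ : ℝ, 0 ≤ θ → θ ≤ 1 →
      Squad X θ ≤ C * X ^ (2 * θ) / Real.log X := by
  obtain ⟨C, hC, hy⟩ := abs_yrho_le
  obtain ⟨A, hA, havg⟩ := exists_sum_primeProd_pow_four_div_le
  refine ⟨C ^ 2 * A * 5, by positivity, fun X hX θ hθ hθ1 ↦ ?_⟩
  have hX0 : 0 < X := by linarith
  have hlog1 : 1 ≤ Real.log X := by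
    rw [Real.le_log_iff_exp_le hX0]
    have := Real.exp_one_lt_d9; linarith
  have hlog0 : 0 < Real.log X := by linarith
  set N : ℕ := ⌈X⌉₊ ^ 2 with hN
  have hmul : ∀ p ∈ mollRange X ×ˢ mollRange X, p.1 * p.2 ≤ N := by
    intro p hp
    obtain ⟨hp1, hp2⟩ := Finset.mem_product.mp hp
    have h1 : p.1 ≤ ⌈X⌉₊ := (Nat.lt_ceil.mpr (mem_mollRange.mp hp1).2).le
    have h2 : p.2 ≤ ⌈X⌉₊ := (Nat.lt_ceil.mpr (mem_mollRange.mp hp2).2).le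
    calc p.1 * p.2 ≤ ⌈X⌉₊ * ⌈X⌉₊ := Nat.mul_le_mul h1 h2
      _ = N := (sq _).symm
  rw [Squad_eq_sum_phiPow_mul_sq hmul]
  -- `log N ≤ 4 log X`
  have hN1 : (1 : ℝ) ≤ N := by
    have : 1 ≤ ⌈X⌉₊ := Nat.one_le_iff_ne_zero.mpr (Nat.ceil_pos.mpr hX0).ne'
    exact_mod_cast Nat.one_le_pow _ _ this
  have hlogN : Real.log N ≤ 4 * Real.log X := by
    have hceil : (⌈X⌉₊ : ℝ) ≤ 2 * X := by
      have := Nat.ceil_lt_add_one hX0.le; linarith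
    have hNle : (N : ℝ) ≤ (2 * X) ^ 2 := by
      rw [hN]; push_cast
      exact pow_le_pow_left₀ (by positivity) hceil 2
    have hlog2 : Real.log 2 ≤ Real.log X := Real.log_le_log (by norm_num) (by linarith)
    calc Real.log N ≤ Real.log ((2 * X) ^ 2) := Real.log_le_log (by positivity) hNle
      _ = 2 * (Real.log 2 + Real.log X) := by
          rw [Real.log_pow, Real.log_mul (by norm_num) hX0.ne']; push_cast; ring
      _ ≤ 4 * Real.log X := by linarith
  have hterm : ∀ ρ ∈ Finset.Icc 1 N, phiPow (1 - θ) ρ * yrho X θ ρ ^ 2 ≤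
      (C ^ 2 * X ^ (2 * θ) / Real.log X ^ 2) * (primeProd ρ ^ 4 / ρ) := by
    intro ρ hρ
    have hρ1 := (Finset.mem_Icc.mp hρ).1
    have hρ0 : ρ ≠ 0 := by omega
    have hρpos : (0 : ℝ) < ρ := by exact_mod_cast hρ1
    have hφ : phiPow (1 - θ) ρ ≤ ρ := by
      refine (phiPow_le_rpow (by linarith) hρ0).trans ?_
      calc (ρ : ℝ) ^ (1 - θ) ≤ (ρ : ℝ) ^ (1 : ℝ) :=
            Real.rpow_le_rpow_of_exponent_le (by exact_mod_cast hρ1) (by linarith)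
        _ = ρ := Real.rpow_one _
    have hyb := hy X hX θ hθ ρ hρ0
    have hy2 : yrho X θ ρ ^ 2 ≤ (C * X ^ θ * primeProd ρ ^ 2 / (ρ * Real.log X)) ^ 2 := by
      rw [← sq_abs]; exact pow_le_pow_left₀ (abs_nonneg _) hyb 2
    have hX2 : (X ^ θ) ^ 2 = X ^ (2 * θ) := by
      rw [← Real.rpow_natCast, ← Real.rpow_mul hX0.le]; ring_nf
    calc phiPow (1 - θ) ρ * yrho X θ ρ ^ 2 ≤ ρ * (C * X ^ θ * primeProd ρ ^ 2 / (ρ * Real.log X)) ^ 2 :=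
          mul_le_mul hφ hy2 (sq_nonneg _) hρpos.le
      _ = (C ^ 2 * (X ^ θ) ^ 2 / Real.log X ^ 2) * (primeProd ρ ^ 4 / ρ) := by
          field_simp
      _ = _ := by rw [hX2]
  calc ∑ ρ ∈ Finset.Icc 1 N, phiPow (1 - θ) ρ * yrho X θ ρ ^ 2
      ≤ ∑ ρ ∈ Finset.Icc 1 N, (C ^ 2 * X ^ (2 * θ) / Real.log X ^ 2) * (primeProd ρ ^ 4 / ρ) :=
        Finset.sum_le_sum hterm
    _ = (C ^ 2 * X ^ (2 * θ) / Real.log X ^ 2) * ∑ ρ ∈ Finset.Icc 1 N, primeProd ρ ^ 4 / ρ := by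
        rw [Finset.mul_sum]
    _ ≤ (C ^ 2 * X ^ (2 * θ) / Real.log X ^ 2) * (A * (1 + Real.log N)) :=
        mul_le_mul_of_nonneg_left (havg N) (by positivity)
    _ ≤ (C ^ 2 * X ^ (2 * θ) / Real.log X ^ 2) * (A * (5 * Real.log X)) := by
        gcongr; linarith
    _ = C ^ 2 * A * 5 * X ^ (2 * θ) / Real.log X := by
        field_simp

end Literature.NumberTheory.LFunctions.SelbergMollifier
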